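import Mathlib
import Summits.Ventures.HodgeRepro.Tier3HeckeIsolation

/-!
# Tier3LocalLiftNonvanishing — the finite-place clause of PERIOD.md §4.3 (b5)
(T3.5 for T3.1)

PERIOD.md §4.3 (b5), finite places: «`θ_v(F_{τ,v}, ·)` spans a non-zero `U(V_v)`-submodule of the irreducible
`π_v`, hence all of `π_v` — so `ϕ_v` with `θ_v(F_{τ,v}, ϕ_v) ≠ 0` exists, and the same `ϕ′_v`-freedom makes
`⟨θ_v(F_{τ,v}, ϕ_v), θ_v(F′_{τ,v}, ϕ′_v)⟩ ≠ 0` once both are non-zero, two non-zero vectors of an irreducible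
unitary `π_v` not being orthogonal for suitable translates».  The first clause is asserted there; it follows
from three facts the page already has — the local theta map `Θ : τ_v × S(V_v ⊗ W_v) → π_v` is `U(W_v)`-equivariant
(`Θ(τ(g) F, ϕ) = Θ(F, ω(g) ϕ)`), `τ_v` is irreducible, and the lift is non-zero (`τ_v` lifts): the set of `F` with
`Θ(F, ·) ≡ 0` is a `U(W_v)`-stable subspace of `τ_v`, proper because the lift is non-zero, hence `0`.  This file is
that argument and its two companions on the abstract data: a field `k`, a type `G` (= `U(W_v)`; its group law is not used) acting on `τ`
by `ρ`, an arbitrary type `S` (the Schwartz space) with functions `ω g : S → S`, `Θ : τ →ₗ[k] (S → π)` additive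
in `F`; irreducibility stated directly as «every `ρ`-stable subspace is `⊥` or `⊤`».
* `kernel_stable` / `kernel_eq_bot` / **`exists_apply_ne_zero`**: `Θ ≠ 0 ⇒ ∀ F ≠ 0, ∃ ϕ, Θ F ϕ ≠ 0`;
* **`span_range_eq_top`**: the span of `{Θ F ϕ : ϕ}` is an `R`-submodule of `π` (`R` = the group ring of
  `U(V_v)`, the span stable by the `U(V_v)`-equivariance in `ϕ`) and `π` is simple ⇒ the span is all of `π`;
* **`exists_exists_smul_pairing_ne_zero`**: with Tier3HeckeIsolation's `exists_smul_pairing_ne_zero_of_isSimpleModule`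
  (a pairing non-degenerate on the simple `π`): for `F, F′ ≠ 0` there are data `ϕ, ϕ′` and a translate `r` with
  `B (r • Θ F ϕ) (Θ F′ ϕ′) ≠ 0` — (b5)'s finite-place sentence as one statement.
What stays on the page: the equivariance of the local theta map, the irreducibility of `τ_v` and `π_v`, the
non-vanishing of the local lift for the `τ` that lift (Howe duality, PERIOD.md (b2)), the unitarity of `π_v`
(the non-degenerate pairing).  No definition, no notation; imports Mathlib and Tier3HeckeIsolation.
Nothing here asserts anything about the original programme; HC_CM is NOT proved by anyone in this repository.
-/

namespace HodgeRepro.T3P1.LocalLift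

section Kernel

variable {k : Type*} [Field k] {G : Type*}
variable {τ : Type*} [AddCommGroup τ] [Module k τ]
variable {S π : Type*} [AddCommGroup π] [Module k π]

/-- The kernel of `Θ : τ →ₗ[k] (S → π)` is stable under `ρ` when `Θ` is equivariant
(`Θ (ρ g F) ϕ = Θ F (ω g ϕ)`): if `Θ F ≡ 0` then `Θ (ρ g F) ≡ 0`. -/
theorem kernel_stable (ρ : G → τ →ₗ[k] τ) (ω : G → S → S) (Θ : τ →ₗ[k] (S → π))
    (hequiv : ∀ g F ϕ, Θ (ρ g F) ϕ = Θ F (ω g ϕ)) (g : G) {F : τ}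
    (hF : F ∈ LinearMap.ker Θ) : ρ g F ∈ LinearMap.ker Θ := by
  rw [LinearMap.mem_ker] at hF ⊢
  funext ϕ
  rw [hequiv, hF]
  rfl

/-- If `τ` is irreducible (every `ρ`-stable subspace is `⊥` or `⊤`) and `Θ ≠ 0`, the kernel of
`Θ` is `⊥`. -/
theorem kernel_eq_bot (ρ : G → τ →ₗ[k] τ) (ω : G → S → S) (Θ : τ →ₗ[k] (S → π))
    (hequiv : ∀ g F ϕ, Θ (ρ g F) ϕ = Θ F (ω g ϕ))
    (hirr : ∀ K : Submodule k τ, (∀ g, ∀ F ∈ K, ρ g F ∈ K) → K = ⊥ ∨ K = ⊤)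
    (hΘ : Θ ≠ 0) : LinearMap.ker Θ = ⊥ := by
  rcases hirr (LinearMap.ker Θ) (fun g F hF => kernel_stable ρ ω Θ hequiv g hF) with h | h
  · exact h
  · exfalso
    apply hΘ
    ext F ϕ
    have hF : F ∈ LinearMap.ker Θ := by rw [h]; exact Submodule.mem_top
    rw [LinearMap.mem_ker] at hF
    simp [hF]

/-- **(b5), finite places, first clause.** For `τ` irreducible and the local lift `Θ` non-zero, every
non-zero `F` lifts non-trivially: some datum `ϕ` has `Θ F ϕ ≠ 0`. -/
theorem exists_apply_ne_zero (ρ : G → τ →ₗ[k] τ) (ω : G → S → S) (Θ : τ →ₗ[k] (S → π))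
    (hequiv : ∀ g F ϕ, Θ (ρ g F) ϕ = Θ F (ω g ϕ))
    (hirr : ∀ K : Submodule k τ, (∀ g, ∀ F ∈ K, ρ g F ∈ K) → K = ⊥ ∨ K = ⊤)
    (hΘ : Θ ≠ 0) {F : τ} (hF : F ≠ 0) : ∃ ϕ : S, Θ F ϕ ≠ 0 := by
  by_contra h
  push Not at h
  have hmem : F ∈ LinearMap.ker Θ := by
    rw [LinearMap.mem_ker]
    funext ϕ
    exact h ϕ
  rw [kernel_eq_bot ρ ω Θ hequiv hirr hΘ, Submodule.mem_bot] at hmem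
  exact hF hmem

end Kernel

section Span

variable {k : Type*} [Field k] {R : Type*} [Ring R]
variable {π : Type*} [AddCommGroup π] [Module k π] [Module R π]

/-- **(b5), finite places, second clause.** If the `k`-span of the values `Θ F ϕ` (`ϕ` over the data) is
stable under `R` (the `U(V_v)`-equivariance in `ϕ`: `R` = the group ring of `U(V_v)`), non-zero, and `π` is
simple over `R`, that span is all of `π`: «`θ_v(F_{τ,v}, ·)` spans a non-zero `U(V_v)`-submodule of the
irreducible `π_v`, hence all of `π_v`». -/
theorem span_range_eq_top [IsSimpleModule R π] {S : Type*} (v : S → π)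
    (hstable : ∀ r : R, ∀ x ∈ Submodule.span k (Set.range v), r • x ∈ Submodule.span k (Set.range v))
    (hne : ∃ ϕ, v ϕ ≠ 0) : Submodule.span k (Set.range v) = ⊤ := by
  -- the `k`-span, as an `R`-submodule
  let N : Submodule R π :=
    { carrier := Submodule.span k (Set.range v)
      add_mem' := fun ha hb => Submodule.add_mem _ ha hb
      zero_mem' := Submodule.zero_mem _
      smul_mem' := fun r x hx => hstable r x hx }
  have hbot : N ≠ ⊥ := by
    intro h
    obtain ⟨ϕ, hϕ⟩ := hne
    have hmem : v ϕ ∈ N := Submodule.subset_span ⟨ϕ, rfl⟩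
    rw [h, Submodule.mem_bot] at hmem
    exact hϕ hmem
  have htop : N = ⊤ := (eq_bot_or_eq_top _).resolve_left hbot
  rw [Submodule.eq_top_iff']
  intro x
  have hx : x ∈ N := by rw [htop]; exact Submodule.mem_top
  exact hx

end Span

section Pairing

variable {k : Type*} [Field k] {G : Type*}
variable {τ : Type*} [AddCommGroup τ] [Module k τ]
variable {R : Type*} [Ring R] {π : Type*} [AddCommGroup π] [Module k π] [Module R π]
variable {S : Type*}

/-- **(b5), finite places, as one statement.** `τ` irreducible under `ρ`, the local lift
`Θ : τ →ₗ[k] (S → π)` equivariant and non-zero, `π` simple over `R` (the translates) with a pairing `B`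
non-degenerate in the sense «every non-zero `y` pairs non-trivially with some `x`»: for `F, F′ ≠ 0` there
are data `ϕ, ϕ′` and a translate `r` with `B (r • Θ F ϕ) (Θ F′ ϕ′) ≠ 0` — «the same `ϕ′_v`-freedom makes
the pairing non-zero once both lifts are, two non-zero vectors of an irreducible unitary `π_v` not being
orthogonal for suitable translates». -/
theorem exists_exists_smul_pairing_ne_zero [IsSimpleModule R π] {κ : Type*} [Zero κ]
    (ρ : G → τ →ₗ[k] τ) (ω : G → S → S) (Θ : τ →ₗ[k] (S → π))
    (hequiv : ∀ g F ϕ, Θ (ρ g F) ϕ = Θ F (ω g ϕ))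
    (hirr : ∀ K : Submodule k τ, (∀ g, ∀ F ∈ K, ρ g F ∈ K) → K = ⊥ ∨ K = ⊤)
    (hΘ : Θ ≠ 0) (B : π → π → κ) (hBnd : ∀ y : π, y ≠ 0 → ∃ x : π, B x y ≠ 0)
    {F F' : τ} (hF : F ≠ 0) (hF' : F' ≠ 0) :
    ∃ ϕ ϕ' : S, ∃ r : R, B (r • Θ F ϕ) (Θ F' ϕ') ≠ 0 := by
  obtain ⟨ϕ, hϕ⟩ := exists_apply_ne_zero ρ ω Θ hequiv hirr hΘ hF
  obtain ⟨ϕ', hϕ'⟩ := exists_apply_ne_zero ρ ω Θ hequiv hirr hΘ hF'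
  obtain ⟨r, hr⟩ :=
    HodgeRepro.T3P1.exists_smul_pairing_ne_zero_of_isSimpleModule (R := R) B hBnd hϕ hϕ'
  exact ⟨ϕ, ϕ', r, hr⟩

end Pairing

end HodgeRepro.T3P1.LocalLift
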